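import Literature.NumberTheory.NumberFields.SqrtTwoTowerTwoGaloisAction
import Literature.NumberTheory.IwasawaTheory.ClassicalMuVanishesLayerOneUnitCertificateTwo
import Literature.NumberTheory.IwasawaTheory.ClassicalMuVanishesLayerThreeGeneralRelationCertificateTwo
import Literature.NumberTheory.IwasawaTheory.ClassGroupPRankLeOfRelationLayerOne
import HarnessLib

/-!
# `μ₂ = 0`, `λ₂ ≤ d` FROM AN ARBITRARY RELATION ROW AT LAYER TWO — SPLIT VARIANT: the relation door read at the first layer
# (`ClassGroupPRankLeOfRelationLayerOne`, up to three dyadic primes, ONE non-norm unit) fed by COORDINATES in `K_2 = K·ℚ(ζ₁₆)⁺` — the class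
# `c = [(q₀, s₂ − t)]`, the generator `σ : s₂ ↦ s₂³ − 3s₂`, ANY exponent vector `(e₀, e₁, e₂, e₃)` with `Σ eᵢXⁱ = (X−1)^d·u + 2g`, `d ≤ 2`, and ONE
# element `y` with `y ∈ σ^i(𝔮)^{eᵢ}` for every `i` (two-generator power memberships) and `N_{K_2/K}(y) = ε·q₀^{Σeᵢ}`

`Proofs`-style file (theorems only: no definition, no named fact, no instance, no `sorry`) in topic `NumberTheory/IwasawaTheory` (namespace = path),
written by the prover seat `bsd-line-att-p4` g46 (cell `bsd-f1-sign2`, route `AlignedTransportAtTwo`; `--supports` stmt-BirchSwinnertonDyer-22298, closes nothing).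
The LAYER-TWO sister of att-p4 g43's `classicalMuVanishes_two_of_generalRelationCert_layer_three` (`ClassicalMuVanishesLayerThreeGeneralRelationCertificateTwo`:
layer three, exactly two dyadic primes) in the SPLIT setting of this seat's `ClassicalMuVanishesLayerTwoRelationCertificateTwoSplit` (at most three primes above `2`,
one unit `ε' ≡ ±3 (mod 𝔭'³)` at a degree-one dyadic prime `𝔭'`, consumer att-p3 g53's `classicalMuVanishes_two_of_relation_of_genusCert_of_sub_three_mem_layer_one`).
It GENERALISES this seat's fixed-shape `(1+σ)²` certificate to EVERY relation shape the door accepts at `m = 2`: `∏_{i<4} σ^i(c)^{eᵢ} = 1` with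
`Σ eᵢ Xⁱ = (X − 1)^d u + 2 g`, `u(1)` odd, `d + 2 ≤ 4` — in particular the LINEAR shape `c^m·σc = 1` (`m` odd: `X + m = (X−1) + (m+1)`, `d = 1`) of the
`λ₂ = 1` fields of the split-stratum census (`−1559`, `−2071`: `𝔮³·σ𝔮` principal).  The principal generator `y` of `𝔄 = ∏ σ^i(𝔮)^{eᵢ}` (`𝔮 = (q₀, s₂ − t)`) is
certified by MEMBERSHIPS `y = Σ_k c_{i,k} q₀^{eᵢ−k} (σ^i s₂ − t)^k` (so `y ∈ σ^i(𝔮)^{eᵢ}`), by the pairwise COPRIMALITY of the four conjugates `σ^i 𝔮` (three Bézout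
identities `α_k q₀ + v_k p_k(t) = 1` in `𝓞_K`, `p_k(t) = (σ^k s₂)(t) − t` the integer polynomials `t³ − 4t`, `−2t`, `−t³ + 2t`), which turns the memberships into
`y ∈ ⋂ σ^i(𝔮)^{eᵢ} = 𝔄`, and by the NORM `N_{K_2/K}(y) = ε q₀^{Σ eᵢ} = N(𝔄)` (so `(y) = 𝔄` by cancellation in the Dedekind domain `𝓞_{K_2}`).

* ★★★ `classicalMuVanishes_two_of_generalRelationCert_layer_two_of_sub_three_mem` — `K` odd degree, `2 ∤ d_K`, `κ` cyclotomic, `#{𝔭 ∣ 2} ≤ 3`, `2 ∤ h_K`;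
  `𝔭'` maximal with `𝓞_K/𝔭' = 𝔽₂`, a unit `ε' ≡ ±3 (mod 𝔭'³)`; `𝔭₁` maximal with `𝓞_K/𝔭₁ = 𝔽₂`, units `≡ ±1 (mod 𝔭₁³)`; DATA: `q₀` (`(q₀)` maximal,
  `q₀ ≡ ±3 (mod 𝔭₁³)`), `t ∈ ℤ`, `ψ : 𝓞_K → ℤ/q` (`ψ q₀ = 0`, `P₂(t) = (t²−2)²−2 = 0`), `α q₀⁴ + β P₂(t) = q₀`, the three coprimality witnesses, exponents
  `e₀ … e₃` with `Σ eᵢ = n` and the polynomial identity, `y` (four coordinates on `1, s₁, s₂, s₁s₂`) with the four membership certificates (universally quantified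
  over commutative rings — a row discharges each by one `linear_combination`), and `(U₀)² − 2(U₁)² = ε q₀ⁿ` with the layer-two norm templates `U₀, U₁`
  ⟹ **`rank₂ Cl(K_l) ≤ d ∀ l`, `μ₂(κ) = 0`, `λ₂(κ) ≤ d`**.

CELL READING (crux C2): the split-stratum seeds `10913b1` (cubic field `−1559`) and `2071a1` (`−2071`) of att-p3 g53's census have the layer-two relation
`𝔮³·σ𝔮 = (y)` (this seat's generator search, pure python seconds): the LINEAR shape, `d = 1`, out of reach of the `(1+σ)²` certificate.
HONEST SCOPE: classical; nothing about any summit is asserted here; BSD is not advanced.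

References: [Washington1997] §13.1, §13.3 Lemmas 13.15, 13.18, Prop. 13.22–13.23; [Lang1990] Ch. 13 §4 Lemma 4.1; [Fukuda1994] Thm. 1; [Gras2003] IV.4;
[NeukirchANT1999] Ch. I §3 (3.1)–(3.3), §8, Ch. III (1.6)–(1.7); [Cohen1993] §4.7, §6.5; [Omeara1963] §63B (63:10).
-/

set_option autoImplicit false

noncomputable section

open scoped NumberField nonZeroDivisors
open NumberField IsDedekindDomain Module Polynomial Finset

namespace Literature.NumberTheory.IwasawaTheory

open Literature.NumberTheory.EllipticCurves Literature.NumberTheory.NumberFields Literature.NumberTheory.NumberFields.AmbiguousClass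

variable {K : Type} [Field K] [NumberField K]

set_option maxHeartbeats 3200000 in
set_option synthInstance.maxHeartbeats 400000 in
/-- ★★★ **`μ₂ = 0`, `λ₂ ≤ d`, `rank₂ Cl(K_l) ≤ d ∀ l` FROM AN ARBITRARY LAYER-TWO RELATION ROW IN COORDINATES — SPLIT VARIANT** (`≤ 3` dyadic primes, one
non-norm unit `ε' ≡ ±3 (mod 𝔭'³)`; hypotheses as in the module docstring). [cite: Washington1997, §13.3 Lemmas 13.15, 13.18, Prop. 13.22–13.23]
[cite: Lang1990, Ch. 13 §4 Lemma 4.1] [cite: NeukirchANT1999, Ch. III (1.6)–(1.7); Ch. I §3 (3.3)] [cite: Cohen1993, §4.7, §6.5] -/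
theorem classicalMuVanishes_two_of_generalRelationCert_layer_two_of_sub_three_mem (hK2 : ¬ 2 ∣ Module.finrank ℚ K) (hd : ¬ (2 : ℤ) ∣ NumberField.discr K)
    (κ : ZpExtension K 2) (hκ : κ.IsCyclotomic)
    (h3card : {w : HeightOneSpectrum (𝓞 K) | ((2 : ℕ) : 𝓞 K) ∈ w.asIdeal}.ncard ≤ 3)
    (hh : ¬ 2 ∣ classNumber K)
    (P' : Ideal (𝓞 K)) [P'.IsMaximal] (hres' : ∀ r : 𝓞 K, r ∈ P' ∨ r - 1 ∈ P') (h2P' : (2 : 𝓞 K) ∈ P')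
    {ε' : (𝓞 K)ˣ} (hε' : (ε' : 𝓞 K) - 3 ∈ P' ^ 3 ∨ (ε' : 𝓞 K) + 3 ∈ P' ^ 3)
    (P : Ideal (𝓞 K)) [P.IsMaximal] (hres : ∀ r : 𝓞 K, r ∈ P ∨ r - 1 ∈ P) (h2P : (2 : 𝓞 K) ∈ P)
    (hunits : ∀ u : (𝓞 K)ˣ, (u : 𝓞 K) - 1 ∈ P ^ 3 ∨ (u : 𝓞 K) + 1 ∈ P ^ 3)
    (q₀ : 𝓞 K) (hq₀ : (Ideal.span {q₀}).IsMaximal) (hπ : q₀ - 3 ∈ P ^ 3 ∨ q₀ + 3 ∈ P ^ 3)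
    (t : ℤ) {q : ℕ} (hq : 1 < q) (ψ : 𝓞 K →+* ZMod q) (hψ : ψ q₀ = 0) {ti : ZMod q} (hti : 2 * ti = 1)
    (hPt : ((t : ZMod q) ^ 2 - 2) ^ 2 - 2 = 0)
    (α β : 𝓞 K) (hBez : α * q₀ ^ 4 + β * (((t : 𝓞 K) ^ 2 - 2) ^ 2 - 2) = q₀)
    (α₁ v₁ : 𝓞 K) (hC₁ : α₁ * q₀ + v₁ * ((-4) * (t : 𝓞 K) + (t : 𝓞 K) ^ 3) = 1)
    (α₂ v₂ : 𝓞 K) (hC₂ : α₂ * q₀ + v₂ * ((-2) * (t : 𝓞 K)) = 1)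
    (α₃ v₃ : 𝓞 K) (hC₃ : α₃ * q₀ + v₃ * (2 * (t : 𝓞 K) + (-1) * (t : 𝓞 K) ^ 3) = 1)
    (e₀ e₁ e₂ e₃ : ℕ) {n d : ℕ} (hn : e₀ + e₁ + e₂ + e₃ = n) (hd2 : d + 2 ≤ 4) {u g : ℤ[X]} (hu : ¬ (2 : ℤ) ∣ u.eval 1)
    (hF : (C (e₀ : ℤ) + C (e₁ : ℤ) * X + C (e₂ : ℤ) * X ^ 2 + C (e₃ : ℤ) * X ^ 3 : ℤ[X]) = (X - 1) ^ d * u + C (2 : ℤ) * g)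
    (y₀ y₁ y₂ y₃ : 𝓞 K)
    (hmem₀ : ∀ (R : Type) [CommRing R] (φ : 𝓞 K →+* R) (S₁ S₂ : R), S₁ ^ 2 = 2 → S₂ ^ 2 = 2 + S₁ →
      ∃ c : ℕ → R, φ y₀ + φ y₁ * S₁ + (φ y₂ + φ y₃ * S₁) * S₂ = ∑ k ∈ Finset.range (e₀ + 1), c k * φ q₀ ^ (e₀ - k) * (S₂ - (t : R)) ^ k)
    (hmem₁ : ∀ (R : Type) [CommRing R] (φ : 𝓞 K →+* R) (S₁ S₂ : R), S₁ ^ 2 = 2 → S₂ ^ 2 = 2 + S₁ →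
      ∃ c : ℕ → R, φ y₀ + φ y₁ * S₁ + (φ y₂ + φ y₃ * S₁) * S₂ = ∑ k ∈ Finset.range (e₁ + 1), c k * φ q₀ ^ (e₁ - k) * (S₁ * S₂ - S₂ - (t : R)) ^ k)
    (hmem₂ : ∀ (R : Type) [CommRing R] (φ : 𝓞 K →+* R) (S₁ S₂ : R), S₁ ^ 2 = 2 → S₂ ^ 2 = 2 + S₁ →
      ∃ c : ℕ → R, φ y₀ + φ y₁ * S₁ + (φ y₂ + φ y₃ * S₁) * S₂ = ∑ k ∈ Finset.range (e₂ + 1), c k * φ q₀ ^ (e₂ - k) * (-S₂ - (t : R)) ^ k)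
    (hmem₃ : ∀ (R : Type) [CommRing R] (φ : 𝓞 K →+* R) (S₁ S₂ : R), S₁ ^ 2 = 2 → S₂ ^ 2 = 2 + S₁ →
      ∃ c : ℕ → R, φ y₀ + φ y₁ * S₁ + (φ y₂ + φ y₃ * S₁) * S₂ = ∑ k ∈ Finset.range (e₃ + 1), c k * φ q₀ ^ (e₃ - k) * (S₂ - S₁ * S₂ - (t : R)) ^ k)
    (ε : (𝓞 K)ˣ)
    (hN : (y₀ ^ 2 + 2 * y₁ ^ 2 - 2 * y₂ ^ 2 - 4 * y₃ ^ 2 - 4 * y₂ * y₃) ^ 2 - 2 * (2 * y₀ * y₁ - y₂ ^ 2 - 2 * y₃ ^ 2 - 4 * y₂ * y₃) ^ 2 = ε * q₀ ^ n) :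
    (∀ l, classGroupPRank κ l ≤ d) ∧ ClassicalMuVanishes κ ∧ classicalLambda κ ≤ d := by
  classical
  haveI : Fact (Nat.Prime 2) := ⟨Nat.prime_two⟩
  -- ### the layers `K₁ ⊂ K₂`
  have h12 : κ.layer 1 ≤ κ.layer 2 := κ.layer_mono one_le_two
  letI alg12 : Algebra (κ.layer 1) (κ.layer 2) := (IntermediateField.inclusion h12).toRingHom.toAlgebra
  haveI tow12 : IsScalarTower K (κ.layer 1) (κ.layer 2) :=
    IsScalarTower.of_algebraMap_eq fun x => ((IntermediateField.inclusion h12).commutes x).symm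
  letI : Algebra (κ.layer 1) (κ.layer (1 + 1)) := alg12
  haveI : IsScalarTower K (κ.layer 1) (κ.layer (1 + 1)) := tow12
  haveI : FiniteDimensional K (κ.layer 1) := κ.finiteDimensional_layer_holds 1
  haveI : FiniteDimensional K (κ.layer 2) := κ.finiteDimensional_layer_holds 2
  haveI : NumberField (κ.layer 1) := NumberField.of_module_finite K _
  haveI : NumberField (κ.layer 2) := NumberField.of_module_finite K _
  haveI : IsGalois K (κ.layer 1) := κ.isGalois_layer_holds 1
  haveI : IsGalois K (κ.layer 2) := κ.isGalois_layer_holds 2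
  haveI : IsGalois (κ.layer 1) (κ.layer 2) := IsGalois.tower_top_of_isGalois K _ _
  haveI : FiniteDimensional (κ.layer 1) (κ.layer 2) := Module.Finite.of_restrictScalars_finite K _ _
  have hdeg1 : Module.finrank K (κ.layer 1) = 2 := by rw [κ.finrank_layer_holds 1, pow_one]
  have hdeg2 : Module.finrank (κ.layer 1) (κ.layer 2) = 2 := finrank_layer_one_layer_two κ
  have hdeg4 : Module.finrank K (κ.layer 2) = 4 := by rw [κ.finrank_layer_holds 2]; norm_num
  -- ### generators `s₁ ∈ K₁`, `s₂ ∈ K₂` and integral copies `S₁, S₂ ∈ 𝓞 K₂`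
  obtain ⟨s₁, hs₁, s₂', hs₂', hs₂K''⟩ := exists_sqrt_two_layer_one_sqrt_two_add_layer_two κ hK2 hκ
  set s₂ : κ.layer 2 := s₂' with hs₂def
  have hs₂ : s₂ ^ 2 = algebraMap (κ.layer 1) (κ.layer 2) (2 + s₁) := hs₂'
  have hs₂K : ∀ x : κ.layer 1, algebraMap (κ.layer 1) (κ.layer 2) x ≠ s₂ := fun x hx => hs₂K'' ⟨x, hx⟩
  clear_value s₂
  clear hs₂' hs₂K'' hs₂def
  have hs₁K : ∀ x : K, algebraMap K (κ.layer 1) x ≠ s₁ := forall_algebraMap_ne_of_sq_eq_two hd hs₁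
  have hs₁int : IsIntegral ℤ s₁ := by
    refine ⟨Polynomial.X ^ 2 - Polynomial.C 2, Polynomial.monic_X_pow_sub_C _ two_ne_zero, ?_⟩
    simp [hs₁]
  have h2int : IsIntegral ℤ (2 : κ.layer 2) := by
    have := isIntegral_algebraMap (R := ℤ) (A := κ.layer 2) (x := (2 : ℤ))
    rwa [map_ofNat] at this
  have hs₂int : IsIntegral ℤ s₂ := by
    refine IsIntegral.of_pow (n := 2) (by norm_num) ?_
    rw [hs₂, map_add, map_ofNat]
    exact h2int.add (map_isIntegral_int _ hs₁int)
  obtain ⟨S₁, hS₁val⟩ : ∃ S : 𝓞 (κ.layer 2), algebraMap (𝓞 (κ.layer 2)) (κ.layer 2) S = algebraMap (κ.layer 1) (κ.layer 2) s₁ :=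
    ⟨⟨_, map_isIntegral_int (algebraMap (κ.layer 1) (κ.layer 2)) hs₁int⟩, rfl⟩
  obtain ⟨S₂, hS₂val⟩ : ∃ S : 𝓞 (κ.layer 2), algebraMap (𝓞 (κ.layer 2)) (κ.layer 2) S = s₂ := ⟨⟨_, hs₂int⟩, rfl⟩
  have hT₁ : (algebraMap (κ.layer 1) (κ.layer 2) s₁) ^ 2 = 2 := by rw [← map_pow, hs₁, map_ofNat]
  have hT₂ : s₂ ^ 2 = 2 + algebraMap (κ.layer 1) (κ.layer 2) s₁ := by rw [hs₂, map_add, map_ofNat]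
  have hS₁ : S₁ ^ 2 = 2 := by
    apply RingOfIntegers.coe_injective
    rw [map_pow, map_ofNat, hS₁val]; exact hT₁
  have hS₂ : S₂ ^ 2 = 2 + S₁ := by
    apply RingOfIntegers.coe_injective
    rw [map_pow, map_add, map_ofNat, hS₂val, hS₁val]; exact hT₂
  set f := algebraMap (𝓞 K) (𝓞 (κ.layer 2)) with hf
  have hcoe : ∀ z : 𝓞 K, algebraMap (𝓞 (κ.layer 2)) (κ.layer 2) (f z) = algebraMap K (κ.layer 2) (z : K) := fun z => by
    rw [hf]
    exact (IsScalarTower.algebraMap_apply (𝓞 K) (𝓞 (κ.layer 2)) (κ.layer 2) z).symm.trans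
      (IsScalarTower.algebraMap_apply (𝓞 K) K (κ.layer 2) z)
  have hia : ∀ (τ : (κ.layer 2) ≃ₐ[K] (κ.layer 2)) (x : 𝓞 (κ.layer 2)),
      algebraMap (𝓞 (κ.layer 2)) (κ.layer 2) ((intAut τ : 𝓞 (κ.layer 2) →+* 𝓞 (κ.layer 2)) x) = τ (algebraMap (𝓞 (κ.layer 2)) (κ.layer 2) x) :=
    fun τ x => rfl
  -- ### the generator `σ` of `Gal(K₂/K)` with `σ s₂ = s₂³ − 3 s₂`
  obtain ⟨σ, hσ⟩ := exists_algEquiv_apply_eq_tower2 (K := K) hdeg1 hdeg2 hs₁ hs₁K hs₂ hs₂K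
  have hgen : ∀ τ : (κ.layer 2) ≃ₐ[K] (κ.layer 2), τ ∈ Subgroup.zpowers σ :=
    forall_mem_zpowers_of_apply_eq_tower2 (K := K) hdeg1 hdeg2 hs₁ hs₁K hs₂ hσ
  obtain ⟨-, hσ1, hσ2, hσ3⟩ := tower2_galois_iterates (K := K) hs₁ hs₂ hσ
  -- ### the ideal `I₀ = (q₀, S₂ − t)` and its conjugates
  have hq₀0 : q₀ ≠ 0 := fun h0 => by
    rw [h0, Ideal.span_singleton_zero] at hq₀
    exact Ring.ne_bot_of_isMaximal_of_not_isField hq₀ (RingOfIntegers.not_isField K) rfl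
  obtain ⟨b, hb⟩ : ∃ b : 𝓞 (κ.layer 2), b = f q₀ := ⟨_, rfl⟩
  have hbL : algebraMap (𝓞 (κ.layer 2)) (κ.layer 2) b = algebraMap K (κ.layer 2) (q₀ : K) := by rw [hb, hcoe]
  have hb0 : b ≠ 0 := fun h => hq₀0 (by
    have h' : algebraMap (𝓞 (κ.layer 2)) (κ.layer 2) b = 0 := by rw [h, map_zero]
    rw [hbL, map_eq_zero_iff _ (algebraMap K (κ.layer 2)).injective] at h'
    exact RingOfIntegers.coe_injective (by simpa using h'))
  have hI0 : Ideal.span {b, S₂ - (t : 𝓞 (κ.layer 2))} ≠ ⊥ := fun h => hb0 (by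
    have : b ∈ Ideal.span {b, S₂ - (t : 𝓞 (κ.layer 2))} := Ideal.subset_span (by simp)
    rw [h, Ideal.mem_bot] at this
    exact this)
  -- `τ I₀ = (q₀, τ s₂ − t)`
  have hmapI : ∀ (τ : (κ.layer 2) ≃ₐ[K] (κ.layer 2)) (Z : 𝓞 (κ.layer 2)), algebraMap (𝓞 (κ.layer 2)) (κ.layer 2) Z = τ s₂ - t →
      (Ideal.span {b, S₂ - (t : 𝓞 (κ.layer 2))}).map (intAut τ : 𝓞 (κ.layer 2) →+* 𝓞 (κ.layer 2)) = Ideal.span {b, Z} := by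
    intro τ Z hZ
    rw [Ideal.map_span, Set.image_pair]
    have h1 : (intAut τ : 𝓞 (κ.layer 2) →+* 𝓞 (κ.layer 2)) b = b := by
      apply RingOfIntegers.coe_injective
      rw [hia, hbL]
      exact τ.commutes (q₀ : K)
    have h2 : (intAut τ : 𝓞 (κ.layer 2) →+* 𝓞 (κ.layer 2)) (S₂ - t) = Z := by
      apply RingOfIntegers.coe_injective
      rw [hia, hZ, map_sub, map_intCast, hS₂val, map_sub, map_intCast]
    rw [h1, h2]
  have hσ0 : (σ ^ 0) s₂ = s₂ := by rw [pow_zero, AlgEquiv.one_apply]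
  have hσ1' : (σ ^ 1) s₂ = algebraMap (κ.layer 1) (κ.layer 2) s₁ * s₂ - s₂ := by rw [pow_one, hσ1]
  have hZ₀ : algebraMap (𝓞 (κ.layer 2)) (κ.layer 2) (S₂ - (t : 𝓞 (κ.layer 2))) = (σ ^ 0) s₂ - t := by
    simp only [map_sub, map_intCast, hS₂val, hσ0]
  have hJ₀ : (Ideal.span {b, S₂ - (t : 𝓞 (κ.layer 2))}).map (intAut (σ ^ 0) : 𝓞 (κ.layer 2) →+* 𝓞 (κ.layer 2)) = Ideal.span {b, S₂ - (t : 𝓞 (κ.layer 2))} :=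
    hmapI (σ ^ 0) _ hZ₀
  have hZ₁ : algebraMap (𝓞 (κ.layer 2)) (κ.layer 2) (S₁ * S₂ - S₂ - (t : 𝓞 (κ.layer 2))) = (σ ^ 1) s₂ - t := by
    simp only [map_sub, map_mul, map_intCast, hS₁val, hS₂val, hσ1']
  have hJ₁ : (Ideal.span {b, S₂ - (t : 𝓞 (κ.layer 2))}).map (intAut (σ ^ 1) : 𝓞 (κ.layer 2) →+* 𝓞 (κ.layer 2)) = Ideal.span {b, S₁ * S₂ - S₂ - (t : 𝓞 (κ.layer 2))} :=
    hmapI (σ ^ 1) _ hZ₁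
  have hZ₂ : algebraMap (𝓞 (κ.layer 2)) (κ.layer 2) (-S₂ - (t : 𝓞 (κ.layer 2))) = (σ ^ 2) s₂ - t := by
    simp only [map_sub, map_neg, map_intCast, hS₂val, hσ2]
  have hJ₂ : (Ideal.span {b, S₂ - (t : 𝓞 (κ.layer 2))}).map (intAut (σ ^ 2) : 𝓞 (κ.layer 2) →+* 𝓞 (κ.layer 2)) = Ideal.span {b, -S₂ - (t : 𝓞 (κ.layer 2))} :=
    hmapI (σ ^ 2) _ hZ₂
  have hZ₃ : algebraMap (𝓞 (κ.layer 2)) (κ.layer 2) (S₂ - S₁ * S₂ - (t : 𝓞 (κ.layer 2))) = (σ ^ 3) s₂ - t := by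
    simp only [map_sub, map_mul, map_intCast, hS₁val, hS₂val, hσ3]
  have hJ₃ : (Ideal.span {b, S₂ - (t : 𝓞 (κ.layer 2))}).map (intAut (σ ^ 3) : 𝓞 (κ.layer 2) →+* 𝓞 (κ.layer 2)) = Ideal.span {b, S₂ - S₁ * S₂ - (t : 𝓞 (κ.layer 2))} :=
    hmapI (σ ^ 3) _ hZ₃
  -- ### the four conjugates are pairwise coprime
  have hcomax₁ : f α₁ * b + (-(f v₁) * ((-1) + S₁ + S₂ * (t : 𝓞 (κ.layer 2)) + (t : 𝓞 (κ.layer 2)) ^ 2)) * (S₂ - (t : 𝓞 (κ.layer 2))) + f v₁ * (S₁ * S₂ - S₂ - (t : 𝓞 (κ.layer 2))) = 1 := by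
    have h := congrArg f hC₁
    simp only [map_add, map_mul, map_one, map_intCast, map_pow, map_neg, map_ofNat] at h
    rw [hb]
    linear_combination h + ((-1) * f v₁ * (t : 𝓞 (κ.layer 2))) * hS₂
  have hcomax₂ : f α₂ * b + (-(f v₂) * ((-1))) * (S₂ - (t : 𝓞 (κ.layer 2))) + f v₂ * (-S₂ - (t : 𝓞 (κ.layer 2))) = 1 := by
    have h := congrArg f hC₂
    simp only [map_add, map_mul, map_one, map_intCast, map_neg, map_ofNat] at h
    rw [hb]
    linear_combination h
  have hcomax₃ : f α₃ * b + (-(f v₃) * (1 + (-1) * S₁ + (-1) * S₂ * (t : 𝓞 (κ.layer 2)) + (-1) * (t : 𝓞 (κ.layer 2)) ^ 2)) * (S₂ - (t : 𝓞 (κ.layer 2))) + f v₃ * (S₂ - S₁ * S₂ - (t : 𝓞 (κ.layer 2))) = 1 := by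
    have h := congrArg f hC₃
    simp only [map_add, map_mul, map_one, map_intCast, map_pow, map_neg, map_ofNat] at h
    rw [hb]
    linear_combination h + (f v₃ * (t : 𝓞 (κ.layer 2))) * hS₂
  have hcop : ∀ k, 0 < k → k < 4 →
      Ideal.span {b, S₂ - (t : 𝓞 (κ.layer 2))} ⊔ (Ideal.span {b, S₂ - (t : 𝓞 (κ.layer 2))}).map (intAut (σ ^ k) : 𝓞 (κ.layer 2) →+* 𝓞 (κ.layer 2)) = ⊤ := by
    intro k hk0 hk4
    interval_cases k
    · rw [hJ₁]; exact span_pair_sup_span_pair_eq_top_of_comax hcomax₁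
    · rw [hJ₂]; exact span_pair_sup_span_pair_eq_top_of_comax hcomax₂
    · rw [hJ₃]; exact span_pair_sup_span_pair_eq_top_of_comax hcomax₃
  have hcomp : ∀ i k : ℕ, (intAut (σ ^ i) : 𝓞 (κ.layer 2) →+* 𝓞 (κ.layer 2)).comp (intAut (σ ^ k) : 𝓞 (κ.layer 2) →+* 𝓞 (κ.layer 2)) = (intAut (σ ^ (i + k)) : 𝓞 (κ.layer 2) →+* 𝓞 (κ.layer 2)) := by
    intro i k
    refine RingHom.ext fun x => RingOfIntegers.coe_injective ?_
    rw [RingHom.comp_apply, hia, hia, hia, ← AlgEquiv.mul_apply, ← pow_add]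
  obtain ⟨e, he0, he1, he2, he3⟩ : ∃ e : ℕ → ℕ, e 0 = e₀ ∧ e 1 = e₁ ∧ e 2 = e₂ ∧ e 3 = e₃ :=
    ⟨fun i => if i = 0 then e₀ else if i = 1 then e₁ else if i = 2 then e₂ else if i = 3 then e₃ else 0, rfl, rfl, rfl, rfl⟩
  have hpair : ((Finset.range 4 : Finset ℕ) : Set ℕ).Pairwise
      (Function.onFun IsCoprime fun i => ((Ideal.span {b, S₂ - (t : 𝓞 (κ.layer 2))}).map (intAut (σ ^ i) : 𝓞 (κ.layer 2) →+* 𝓞 (κ.layer 2))) ^ e i) := by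
    have key : ∀ i j : ℕ, i < j → j < 4 → IsCoprime (((Ideal.span {b, S₂ - (t : 𝓞 (κ.layer 2))}).map (intAut (σ ^ i) : 𝓞 (κ.layer 2) →+* 𝓞 (κ.layer 2))) ^ e i)
        (((Ideal.span {b, S₂ - (t : 𝓞 (κ.layer 2))}).map (intAut (σ ^ j) : 𝓞 (κ.layer 2) →+* 𝓞 (κ.layer 2))) ^ e j) := by
      intro i j hij hj4
      rw [Ideal.isCoprime_iff_sup_eq]
      apply Ideal.pow_sup_pow_eq_top
      have h := congrArg (Ideal.map (intAut (σ ^ i) : 𝓞 (κ.layer 2) →+* 𝓞 (κ.layer 2))) (hcop (j - i) (by omega) (by omega))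
      rw [Ideal.map_sup, Ideal.map_top, Ideal.map_map, hcomp i (j - i), show i + (j - i) = j by omega] at h
      exact h
    intro i hi j hj hij
    rw [Finset.coe_range, Set.mem_Iio] at hi hj
    rcases Nat.lt_or_gt_of_ne hij with h | h
    · exact key i j h hj
    · exact (key j i h hi).symm
  -- ### `y ∈ σ^i(I₀)^(e i)` for every `i`, hence `y ∈ ⋂ = ∏`
  obtain ⟨Y, hYdef⟩ : ∃ Y : 𝓞 (κ.layer 2), Y = f y₀ + f y₁ * S₁ + (f y₂ + f y₃ * S₁) * S₂ := ⟨_, rfl⟩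
  have hY₀ : Y ∈ ((Ideal.span {b, S₂ - (t : 𝓞 (κ.layer 2))}).map (intAut (σ ^ 0) : 𝓞 (κ.layer 2) →+* 𝓞 (κ.layer 2))) ^ e 0 := by
    obtain ⟨c, hc⟩ := hmem₀ (𝓞 (κ.layer 2)) f S₁ S₂ hS₁ hS₂
    rw [he0, hJ₀, hYdef, hc, hb]
    exact sum_mul_pow_mul_pow_mem_span_pair_pow _ _ _ _
  have hY₁ : Y ∈ ((Ideal.span {b, S₂ - (t : 𝓞 (κ.layer 2))}).map (intAut (σ ^ 1) : 𝓞 (κ.layer 2) →+* 𝓞 (κ.layer 2))) ^ e 1 := by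
    obtain ⟨c, hc⟩ := hmem₁ (𝓞 (κ.layer 2)) f S₁ S₂ hS₁ hS₂
    rw [he1, hJ₁, hYdef, hc, hb]
    exact sum_mul_pow_mul_pow_mem_span_pair_pow _ _ _ _
  have hY₂ : Y ∈ ((Ideal.span {b, S₂ - (t : 𝓞 (κ.layer 2))}).map (intAut (σ ^ 2) : 𝓞 (κ.layer 2) →+* 𝓞 (κ.layer 2))) ^ e 2 := by
    obtain ⟨c, hc⟩ := hmem₂ (𝓞 (κ.layer 2)) f S₁ S₂ hS₁ hS₂
    rw [he2, hJ₂, hYdef, hc, hb]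
    exact sum_mul_pow_mul_pow_mem_span_pair_pow _ _ _ _
  have hY₃ : Y ∈ ((Ideal.span {b, S₂ - (t : 𝓞 (κ.layer 2))}).map (intAut (σ ^ 3) : 𝓞 (κ.layer 2) →+* 𝓞 (κ.layer 2))) ^ e 3 := by
    obtain ⟨c, hc⟩ := hmem₃ (𝓞 (κ.layer 2)) f S₁ S₂ hS₁ hS₂
    rw [he3, hJ₃, hYdef, hc, hb]
    exact sum_mul_pow_mul_pow_mem_span_pair_pow _ _ _ _
  have hYinf : Y ∈ ⨅ i ∈ Finset.range 4, ((Ideal.span {b, S₂ - (t : 𝓞 (κ.layer 2))}).map (intAut (σ ^ i) : 𝓞 (κ.layer 2) →+* 𝓞 (κ.layer 2))) ^ e i := by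
    refine (Submodule.mem_iInf _).mpr fun i => (Submodule.mem_iInf _).mpr fun hi => ?_
    rw [Finset.mem_range] at hi
    interval_cases i
    · exact hY₀
    · exact hY₁
    · exact hY₂
    · exact hY₃
  have hYA : Y ∈ ∏ i ∈ Finset.range 4, ((Ideal.span {b, S₂ - (t : 𝓞 (κ.layer 2))}).map (intAut (σ ^ i) : 𝓞 (κ.layer 2) →+* 𝓞 (κ.layer 2))) ^ e i := by
    rw [Ideal.prod_eq_iInf_of_pairwise_isCoprime hpair]
    exact hYinf
  -- ### norms: `N(I₀) = (q₀)`, `N(y) = ε q₀ⁿ`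
  have hnormq : Algebra.intNorm (𝓞 K) (𝓞 (κ.layer 2)) b = q₀ ^ 4 := by
    apply RingOfIntegers.coe_injective
    rw [Algebra.algebraMap_intNorm (A := 𝓞 K) (K := K) (L := κ.layer 2) (B := 𝓞 (κ.layer 2)) b, hbL, Algebra.norm_algebraMap, hdeg4, map_pow]
  have hnormz : Algebra.intNorm (𝓞 K) (𝓞 (κ.layer 2)) (S₂ - t) = ((t : 𝓞 K) ^ 2 - 2) ^ 2 - 2 := by
    apply RingOfIntegers.coe_injective
    rw [Algebra.algebraMap_intNorm (A := 𝓞 K) (K := K) (L := κ.layer 2) (B := 𝓞 (κ.layer 2)) (S₂ - t), map_sub, map_intCast, hS₂val]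
    have hz : (s₂ - t : κ.layer 2) = algebraMap K (κ.layer 2) (-(t : K)) + algebraMap K (κ.layer 2) 0 * algebraMap (κ.layer 1) (κ.layer 2) s₁
        + (algebraMap K (κ.layer 2) 1 + algebraMap K (κ.layer 2) 0 * algebraMap (κ.layer 1) (κ.layer 2) s₁) * s₂ := by
      simp only [map_neg, map_intCast, map_zero, map_one]; ring
    rw [hz, norm_tower2_eq hdeg1 hdeg2 hs₁ hs₁K hs₂ hs₂K (-(t : K)) 0 1 0]
    simp only [map_sub, map_pow, map_intCast, map_ofNat]
    ring
  have hqmem : q₀ ∈ Ideal.relNorm (𝓞 K) (Ideal.span {b, S₂ - (t : 𝓞 (κ.layer 2))}) := by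
    have h1 : Algebra.intNorm (𝓞 K) (𝓞 (κ.layer 2)) b ∈ Ideal.relNorm (𝓞 K) (Ideal.span {b, S₂ - (t : 𝓞 (κ.layer 2))}) :=
      Ideal.intNorm_mem_spanNorm (R := 𝓞 K) (Ideal.subset_span (by simp))
    have h2 : Algebra.intNorm (𝓞 K) (𝓞 (κ.layer 2)) (S₂ - t) ∈ Ideal.relNorm (𝓞 K) (Ideal.span {b, S₂ - (t : 𝓞 (κ.layer 2))}) :=
      Ideal.intNorm_mem_spanNorm (R := 𝓞 K) (Ideal.subset_span (by simp))
    rw [hnormq] at h1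
    rw [hnormz] at h2
    rw [← hBez]
    exact Ideal.add_mem _ (Ideal.mul_mem_left _ _ h1) (Ideal.mul_mem_left _ _ h2)
  have hI0top : Ideal.span {b, S₂ - (t : 𝓞 (κ.layer 2))} ≠ ⊤ := by
    rw [hb]
    exact span_pair_ne_top_of_residue_tower2 hdeg1 hdeg2 hs₁ hs₁K hs₂ hs₂K q₀ t hq ψ hψ hti hPt hS₂val
  have hNI₀ : Ideal.relNorm (𝓞 K) (Ideal.span {b, S₂ - (t : 𝓞 (κ.layer 2))}) = Ideal.span {q₀} := by
    have hle : Ideal.span {q₀} ≤ Ideal.relNorm (𝓞 K) (Ideal.span {b, S₂ - (t : 𝓞 (κ.layer 2))}) := (Ideal.span_singleton_le_iff_mem _).mpr hqmem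
    have hne : Ideal.relNorm (𝓞 K) (Ideal.span {b, S₂ - (t : 𝓞 (κ.layer 2))}) ≠ ⊤ := fun htop => hI0top (by
      have h := Ideal.relNorm_le_comap (𝓞 K) (Ideal.span {b, S₂ - (t : 𝓞 (κ.layer 2))})
      rw [htop, top_le_iff, Ideal.comap_eq_top_iff] at h
      exact h)
    exact (hq₀.eq_of_le hne hle).symm
  have hnormy : Algebra.intNorm (𝓞 K) (𝓞 (κ.layer 2)) (f y₀ + f y₁ * S₁ + (f y₂ + f y₃ * S₁) * S₂) = ε * q₀ ^ n := by
    apply RingOfIntegers.coe_injective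
    rw [Algebra.algebraMap_intNorm (A := 𝓞 K) (K := K) (L := κ.layer 2) (B := 𝓞 (κ.layer 2))]
    have hz : algebraMap (𝓞 (κ.layer 2)) (κ.layer 2) (f y₀ + f y₁ * S₁ + (f y₂ + f y₃ * S₁) * S₂) =
        algebraMap K (κ.layer 2) (y₀ : K) + algebraMap K (κ.layer 2) (y₁ : K) * algebraMap (κ.layer 1) (κ.layer 2) s₁
        + (algebraMap K (κ.layer 2) (y₂ : K) + algebraMap K (κ.layer 2) (y₃ : K) * algebraMap (κ.layer 1) (κ.layer 2) s₁) * s₂ := by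
      simp only [map_add, map_mul, hcoe, hS₁val, hS₂val]
    have gN := congrArg (algebraMap (𝓞 K) K) hN
    simp only [map_add, map_sub, map_mul, map_pow, map_ofNat] at gN
    rw [hz, norm_tower2_eq hdeg1 hdeg2 hs₁ hs₁K hs₂ hs₂K]
    exact gN
  have hconj : ∀ τ : (κ.layer 2) ≃ₐ[K] (κ.layer 2),
      Ideal.relNorm (𝓞 K) ((Ideal.span {b, S₂ - (t : 𝓞 (κ.layer 2))}).map (intAut τ : 𝓞 (κ.layer 2) →+* 𝓞 (κ.layer 2))) = Ideal.span {q₀} := by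
    intro τ
    have hpt : ∀ x : 𝓞 (κ.layer 2), (intAut τ : 𝓞 (κ.layer 2) →+* 𝓞 (κ.layer 2)) x = galRestrict (𝓞 K) K (κ.layer 2) (𝓞 (κ.layer 2)) τ x := by
      intro x
      apply RingOfIntegers.coe_injective
      rw [hia, algebraMap_galRestrict_apply]
    have hm : (Ideal.span {b, S₂ - (t : 𝓞 (κ.layer 2))}).map (intAut τ : 𝓞 (κ.layer 2) →+* 𝓞 (κ.layer 2)) =
        (Ideal.span {b, S₂ - (t : 𝓞 (κ.layer 2))}).map (galRestrict (𝓞 K) K (κ.layer 2) (𝓞 (κ.layer 2)) τ) := by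
      unfold Ideal.map
      congr 1
      ext z
      simp only [Set.mem_image, SetLike.mem_coe, hpt]
    rw [hm, Ideal.relNorm_map_algEquiv, hNI₀]
  have hsum : ∑ i ∈ Finset.range 4, e i = n := by
    simp only [Finset.sum_range_succ, Finset.sum_range_zero, zero_add, he0, he1, he2, he3]
    exact hn
  have hrelNormA : Ideal.relNorm (𝓞 K) (∏ i ∈ Finset.range 4, ((Ideal.span {b, S₂ - (t : 𝓞 (κ.layer 2))}).map (intAut (σ ^ i) : 𝓞 (κ.layer 2) →+* 𝓞 (κ.layer 2))) ^ e i) =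
      Ideal.span {q₀} ^ n := by
    rw [map_prod]
    simp_rw [map_pow, hconj]
    rw [Finset.prod_pow_eq_pow_sum, hsum]
  have hyA : Ideal.span {Y} = ∏ i ∈ Finset.range 4, ((Ideal.span {b, S₂ - (t : 𝓞 (κ.layer 2))}).map (intAut (σ ^ i) : 𝓞 (κ.layer 2) →+* 𝓞 (κ.layer 2))) ^ e i := by
    have hle := (Ideal.span_singleton_le_iff_mem _).mpr hYA
    obtain ⟨C, hC⟩ := Ideal.dvd_iff_le.mpr hle
    have hNy : Ideal.relNorm (𝓞 K) (Ideal.span {Y}) = Ideal.span {q₀} ^ n := by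
      rw [Ideal.relNorm_singleton, hYdef, hnormy, Ideal.span_singleton_pow]
      exact Ideal.span_singleton_eq_span_singleton.mpr ⟨ε⁻¹, by rw [mul_comm (ε : 𝓞 K) (q₀ ^ n), mul_assoc, Units.mul_inv, mul_one]⟩
    have hne : Ideal.span {q₀} ^ n ≠ 0 := pow_ne_zero _ (by rw [Ne, Ideal.zero_eq_bot, Ideal.span_singleton_eq_bot]; exact hq₀0)
    have hNC : Ideal.relNorm (𝓞 K) C = ⊤ := by
      have h := congrArg (Ideal.relNorm (𝓞 K)) hC
      rw [map_mul, hNy, hrelNormA] at h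
      have h' : Ideal.span {q₀} ^ n * Ideal.relNorm (𝓞 K) C = Ideal.span {q₀} ^ n * ⊤ := by rw [Ideal.mul_top]; exact h.symm
      exact mul_left_cancel₀ hne h'
    have hCtop : C = ⊤ := by
      by_contra hC'
      obtain ⟨M, hM, hCM⟩ := Ideal.exists_le_maximal C hC'
      have h := Ideal.relNorm_mono (𝓞 K) hCM
      rw [hNC, top_le_iff] at h
      haveI := hM
      haveI : (M.under (𝓞 K)).IsMaximal := Ideal.IsMaximal.under (𝓞 K) M
      rw [Ideal.relNorm_eq_pow_of_isMaximal M (M.under (𝓞 K)), Ideal.pow_eq_top_iff] at h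
      rcases h with h | h
      · exact (Ideal.IsMaximal.ne_top inferInstance) h
      · exact (Ideal.inertiaDeg_pos M (R := 𝓞 K)).ne' h
    rw [hC, hCtop, Ideal.mul_top]
  -- ### the relation and the door
  have hrel := prod_pow_mulEquiv_intAut_mk0_eq_one (F := K) σ hI0 hyA.symm
  have hA0 : Ideal.relNorm (𝓞 (κ.layer 1)) (Ideal.span {b, S₂ - (t : 𝓞 (κ.layer 2))}) ≠ ⊥ :=
    (Ideal.relNorm_eq_bot_iff (R := 𝓞 (κ.layer 1))).not.mpr hI0
  have hA : Ideal.relNorm (𝓞 K) (Ideal.relNorm (𝓞 (κ.layer 1)) (Ideal.span {b, S₂ - (t : 𝓞 (κ.layer 2))})) ^ 1 = Ideal.span {q₀} := by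
    rw [pow_one, Ideal.relNorm_relNorm, hNI₀]
  have hcA : classGroupNorm (κ.layer 1) (κ.layer 2) (ClassGroup.mk0 ⟨Ideal.span {b, S₂ - (t : 𝓞 (κ.layer 2))}, mem_nonZeroDivisors_of_ne_zero hI0⟩) =
      ClassGroup.mk0 ⟨Ideal.relNorm (𝓞 (κ.layer 1)) (Ideal.span {b, S₂ - (t : 𝓞 (κ.layer 2))}), mem_nonZeroDivisors_of_ne_zero hA0⟩ :=
    classGroupNorm_mk0 (κ.layer 1) ⟨_, mem_nonZeroDivisors_of_ne_zero hI0⟩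
  have hF' : (∑ i ∈ Finset.range 4, C ((e i : ℕ) : ℤ) * X ^ i : ℤ[X]) = (X - 1) ^ d * u + C (2 : ℤ) * g := by
    simp only [Finset.sum_range_succ, Finset.sum_range_zero, zero_add, pow_zero, mul_one, pow_one, he0, he1, he2, he3]
    exact hF
  exact classicalMuVanishes_two_of_relation_of_genusCert_of_sub_three_mem_layer_one hK2 hd κ hκ h3card hh (m := 2) (by norm_num) P' hres' h2P' hε'
    P hres h2P hunits hπ hA0 hA σ hgen hcA (N := 4) (d := d) (show d + 2 ≤ 2 ^ 2 by norm_num; omega) hu hF' hrel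

end Literature.NumberTheory.IwasawaTheory

end
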